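import Literature.Computability.Cryptography.LWEPrimePowerAggregate
import Literature.Computability.Cryptography.LWEPiLawMaps
import Literature.Probability.Distributions.IndepProductLawKernels
import Literature.Computability.Cryptography.IndepLawBridge
import HarnessLib

/-!
# Transporting an `LWE` distinguisher: more samples (padding) and wider noise (adding fresh noise)

Topic `Computability/Cryptography` (LWE), grouping namespace `LWE`. Proved glue (no named fact) towards
`Literature.Computability.Cryptography.blprs_gapSVP_sqrt_dim_to_lwe_classical` (**pqc.S21**), hypothesis
`h₃` of `BLPRSReduction.lean`. BLPRS 2013, Thm. 4.1 hands back distinguishers for `LWE_k` on DIFFERENT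
numbers of samples (`m` for the middle branch, `m_fel` for the two `extLWE` branches) and, for the middle
branch, for a WIDER noise (`√(5n)α` instead of `α`: *"the trivial reduction from `LWE_{k,m,q,α}` to
`LWE_{k+1,m,q,√(5n)α}` (which incurs no loss in advantage)"*, arXiv:1306.0281, p. 17 — one adds fresh
Gaussian noise to `b`). To present all of them as distinguishers for ONE problem `LWE_{k,m*,q,χ}` (the
format of `DistinguishesSmallDim` in `BLPRSReduction.lean`) this file proves:

* `padThen h D` (`m₁ ≤ m₂`: run `D` on the first `m₁` samples) with the EXACT laws `iidPMF_map_castLE`,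
  `uniformSamples_map_castLE`, `lweSamplesUniformSecret_map_castLE` and
  **`distinguishingAdvantage_padThen`** (`Adv_{m₂}[padThen D] = Adv_{m₁}[D]`);
* `addNoiseSample`, `raiseThen χ' D` (add independent fresh noise `e'ᵢ ← χ'` to every `bᵢ`, then run `D`)
  with the EXACT laws `lweSample_bind_addNoise` (`A_{s,χ} ↦ A_{s,χ⋆χ'}`), `uniform_bind_addNoise`
  (`U ↦ U`), `lweSamples_bind_addNoise`, `uniformSamples_bind_addNoise`,
  `lweSamplesUniformSecret_bind_addNoise` and **`distinguishingAdvantage_raiseThen`**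
  (`Adv_χ[raiseThen χ' D] = Adv_{χ⋆χ'}[D]`);
* the discretised-Gaussian case **`distinguishingAdvantage_raiseThen_discretizedGaussian_ge`**:
  `Adv_{Ψ̄_t}[raiseThen Ψ̄_u D] ≥ Adv_{Ψ̄_{√(t²+u²)}}[D] - m/(2Qt)` (the discrete convolution
  `Ψ̄_t ⋆ Ψ̄_u` is within `1/(2Qt)` of `Ψ̄_{√(t²+u²)}`, `LWEPrimePowerNoiseSum.lean`; at pqc.S21's modulus
  `Q = 2^{⌊d/2⌋+2}` this defect is negligible).

## References

* Z. Brakerski, A. Langlois, C. Peikert, O. Regev, D. Stehlé, *Classical hardness of learning with errors*,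
  STOC 2013; arXiv:1306.0281, proof of Thm. 4.1 (p. 17: the trivial noise-raising reduction) and
  Def. 2.11 (`LWE_{n,m,q,φ}`, bounded number of samples). [BrakerskiEtAl2013]
* O. Regev, *On lattices, learning with errors …*, J. ACM 56 (2009), §4 (average-case decision `LWE`).
  [RegevLWE2009]
-/

noncomputable section

open scoped ENNReal
open Literature.Probability.Distributions

namespace Literature.Computability.Cryptography

namespace LWE

open MP12

/-! ### Padding: a distinguisher on `m₁` samples is one on `m₂ ≥ m₁` samples -/

section Pad

variable {ι : Type} [Fintype ι] [DecidableEq ι] {R : Type} [CommRing R] [Fintype R] {m₁ m₂ : ℕ}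

/-- **Run `D` on the first `m₁` of `m₂` samples.** [cite: BrakerskiEtAl2013, Def. 2.11 (bounded number of samples)] -/
def padThen (h : m₁ ≤ m₂) (D : Distinguisher ι R m₁) : Distinguisher ι R m₂ :=
  fun S => D fun i => S (Fin.castLE h i)

/-- The first `m₁` coordinates of an iid `m₂`-tuple form an iid `m₁`-tuple. [folklore] -/
theorem iidPMF_map_castLE {α : Type} [Fintype α] (p : PMF α) (h : m₁ ≤ m₂) :
    (iidPMF p m₂).map (fun v (i : Fin m₁) => v (Fin.castLE h i)) = iidPMF p m₁ := by
  rw [← piLaw_const_eq_iidPMF, ← piLaw_const_eq_iidPMF]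
  exact piLaw_map_restrict (Fin.castLEEmb h) fun _ => p

/-- The first `m₁` of `m₂` uniform samples are `m₁` uniform samples. [folklore] -/
theorem uniformSamples_map_castLE (h : m₁ ≤ m₂) :
    (uniformSamples ι R m₂).map (fun S (i : Fin m₁) => S (Fin.castLE h i)) = uniformSamples ι R m₁ := by
  rw [uniformSamples_eq_iidPMF_holds, uniformSamples_eq_iidPMF_holds, iidPMF_map_castLE]

/-- The first `m₁` of `m₂` samples of `A_{s,χ}` are `m₁` samples of `A_{s,χ}`. [folklore] -/
theorem lweSamples_map_castLE (χ : PMF R) (s : ι → R) (h : m₁ ≤ m₂) :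
    (lweSamples χ s m₂).map (fun S (i : Fin m₁) => S (Fin.castLE h i)) = lweSamples χ s m₁ := by
  rw [lweSamples, lweSamples, iidPMF_map_castLE]

/-- The same with a uniform secret. [folklore] -/
theorem lweSamplesUniformSecret_map_castLE (χ : PMF R) (h : m₁ ≤ m₂) :
    (lweSamplesUniformSecret (ι := ι) χ m₂).map (fun S (i : Fin m₁) => S (Fin.castLE h i)) = lweSamplesUniformSecret χ m₁ := by
  rw [lweSamplesUniformSecret, lweSamplesUniformSecret, PMF.map_bind]
  exact congrArg _ (funext fun s => lweSamples_map_castLE χ s h)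

omit [Fintype ι] [DecidableEq ι] [CommRing R] [Fintype R] in
/-- Acceptance probability of the padded test. [folklore] -/
theorem acceptProb_padThen (h : m₁ ≤ m₂) (D : Distinguisher ι R m₁) (P : PMF (Fin m₂ → (ι → R) × R)) :
    acceptProb (padThen h D) P = acceptProb D (P.map fun S (i : Fin m₁) => S (Fin.castLE h i)) := by
  unfold acceptProb padThen
  rw [PMF.bind_map]
  rfl

/-- **Padding loses nothing**: `Adv_{m₂}[padThen D] = Adv_{m₁}[D]`. [cite: BrakerskiEtAl2013, Def. 2.11 (bounded number of samples)] -/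
theorem distinguishingAdvantage_padThen (χ : PMF R) (h : m₁ ≤ m₂) (D : Distinguisher ι R m₁) :
    distinguishingAdvantage χ m₂ (padThen h D) = distinguishingAdvantage χ m₁ D := by
  unfold distinguishingAdvantage
  rw [acceptProb_padThen, acceptProb_padThen, lweSamplesUniformSecret_map_castLE, uniformSamples_map_castLE]

end Pad

/-! ### Raising the noise: add fresh independent noise to every `b` -/

section Raise

variable {ι : Type} [Fintype ι] [DecidableEq ι] {R : Type} [CommRing R] [Fintype R] {m : ℕ}

/-- Add the noise value `e` to the second component of a sample. [cite: BrakerskiEtAl2013, Thm. 4.1 (proof, p. 17: the trivial noise-raising reduction)] -/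
def addNoiseSample (x : (ι → R) × R) (e : R) : (ι → R) × R := (x.1, x.2 + e)

/-- **Add fresh noise `e'ᵢ ← χ'` independently to every `bᵢ`, then run `D`.**
[cite: BrakerskiEtAl2013, Thm. 4.1 (proof, p. 17)] -/
def raiseThen (χ' : PMF R) (m : ℕ) (D : Distinguisher ι R m) : Distinguisher ι R m :=
  fun S => (iidPMF χ' m).bind fun e => D fun i => addNoiseSample (S i) (e i)

/-- **One sample: `A_{s,χ} ↦ A_{s,χ⋆χ'}` exactly.** [cite: BrakerskiEtAl2013, Thm. 4.1 (proof, p. 17)] -/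
theorem lweSample_bind_addNoise (χ χ' : PMF R) (s : ι → R) :
    ((lweSample χ s).bind fun x => χ'.map (addNoiseSample x)) = lweSample (addConv χ χ') s := by
  unfold lweSample addConv
  rw [PMF.bind_bind]
  refine congrArg _ (funext fun a => ?_)
  rw [PMF.bind_map, PMF.map_bind]
  refine congrArg _ (funext fun e₁ => ?_)
  rw [Function.comp_apply, PMF.map_comp]
  congr 1
  funext e₂
  simp only [Function.comp_apply, addNoiseSample, add_assoc]

/-- **One sample: uniform stays uniform** (for each `e` the map `(a, b) ↦ (a, b + e)` is a bijection).
[folklore] -/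
theorem uniform_bind_addNoise (χ' : PMF R) :
    ((PMF.uniformOfFintype ((ι → R) × R)).bind fun x => χ'.map (addNoiseSample x)) = PMF.uniformOfFintype ((ι → R) × R) := by
  rw [show (fun x : (ι → R) × R => χ'.map (addNoiseSample x)) = fun x => χ'.bind fun e => PMF.pure (addNoiseSample x e) from rfl,
    PMF.bind_comm]
  have h : ∀ e : R, ((PMF.uniformOfFintype ((ι → R) × R)).bind fun x => PMF.pure (addNoiseSample x e)) =
      PMF.uniformOfFintype ((ι → R) × R) := by
    intro e
    have hbij : Function.Bijective fun x : (ι → R) × R => addNoiseSample x e :=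
      ⟨fun x y hxy => by
        simp only [addNoiseSample, Prod.mk.injEq, add_left_inj] at hxy
        exact Prod.ext hxy.1 hxy.2,
       fun y => ⟨(y.1, y.2 - e), by simp [addNoiseSample]⟩⟩
    exact uniformOfFintype_map_of_bijective hbij
  simp_rw [h]
  exact PMF.bind_const _ _

/-- **`m` samples: `A_{s,χ}^m ↦ A_{s,χ⋆χ'}^m` exactly.** [cite: BrakerskiEtAl2013, Thm. 4.1 (proof, p. 17)] -/
theorem lweSamples_bind_addNoise (χ χ' : PMF R) (s : ι → R) (m : ℕ) :
    ((lweSamples χ s m).bind fun S => (iidPMF χ' m).map fun e i => addNoiseSample (S i) (e i)) =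
      lweSamples (addConv χ χ') s m := by
  rw [lweSamples, lweSamples, ← indepLaw_const, ← indepLaw_const, ← indepLaw_const,
    indepLaw_bind_indepLaw_map m _ _ (fun _ => addNoiseSample)]
  exact congrArg (indepLaw m) (funext fun _ => lweSample_bind_addNoise χ χ' s)

/-- **`m` samples: `U^m ↦ U^m` exactly.** [folklore] -/
theorem uniformSamples_bind_addNoise (χ' : PMF R) (m : ℕ) :
    ((uniformSamples ι R m).bind fun S => (iidPMF χ' m).map fun e i => addNoiseSample (S i) (e i)) = uniformSamples ι R m := by
  rw [uniformSamples_eq_iidPMF_holds, ← indepLaw_const, ← indepLaw_const, indepLaw_bind_indepLaw_map m _ _ (fun _ => addNoiseSample)]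
  exact congrArg (indepLaw m) (funext fun _ => uniform_bind_addNoise χ')

/-- The uniform-secret version. [folklore] -/
theorem lweSamplesUniformSecret_bind_addNoise (χ χ' : PMF R) (m : ℕ) :
    ((lweSamplesUniformSecret (ι := ι) χ m).bind fun S => (iidPMF χ' m).map fun e i => addNoiseSample (S i) (e i)) =
      lweSamplesUniformSecret (addConv χ χ') m := by
  rw [lweSamplesUniformSecret, lweSamplesUniformSecret, PMF.bind_bind]
  exact congrArg _ (funext fun s => lweSamples_bind_addNoise χ χ' s m)

omit [Fintype ι] [DecidableEq ι] [Fintype R] in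
/-- Acceptance probability of the noise-raised test. [folklore] -/
theorem acceptProb_raiseThen (χ' : PMF R) (D : Distinguisher ι R m) (P : PMF (Fin m → (ι → R) × R)) :
    acceptProb (raiseThen χ' m D) P = acceptProb D (P.bind fun S => (iidPMF χ' m).map fun e i => addNoiseSample (S i) (e i)) := by
  unfold acceptProb raiseThen
  rw [PMF.bind_bind]
  refine congrArg (fun p : PMF Bool => p true) (congrArg _ (funext fun S => ?_))
  rw [PMF.bind_map]
  rfl

/-- **Raising the noise is exact at the level of laws**: `Adv_χ[raiseThen χ' D] = Adv_{χ⋆χ'}[D]`.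
[cite: BrakerskiEtAl2013, Thm. 4.1 (proof, p. 17: "incurs no loss in advantage")] -/
theorem distinguishingAdvantage_raiseThen (χ χ' : PMF R) (D : Distinguisher ι R m) :
    distinguishingAdvantage χ m (raiseThen χ' m D) = distinguishingAdvantage (addConv χ χ') m D := by
  unfold distinguishingAdvantage
  rw [acceptProb_raiseThen, acceptProb_raiseThen, lweSamplesUniformSecret_bind_addNoise, uniformSamples_bind_addNoise]

/-- **The discretised-Gaussian case**: a distinguisher for `LWE_{Ψ̄_{√(t²+u²)}}` becomes one for `LWE_{Ψ̄_t}`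
by adding `Ψ̄_u` noise, losing at most `m/(2Qt)` (the discrete convolution defect of
`tvDist_addConv_discretizedGaussian_le`). [cite: BrakerskiEtAl2013, Thm. 4.1 (proof, p. 17), discrete model] -/
theorem distinguishingAdvantage_raiseThen_discretizedGaussian_ge {n Q : ℕ} [NeZero Q] {t : ℝ} (ht : 0 < t) (u : ℝ) (m : ℕ)
    (D : Distinguisher (Fin n) (ZMod Q) m) :
    distinguishingAdvantage (discretizedGaussian Q (Real.sqrt (t ^ 2 + u ^ 2))) m D - m * (1 / (2 * Q * t)) ≤
      distinguishingAdvantage (discretizedGaussian Q t) m (raiseThen (discretizedGaussian Q u) m D) := by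
  rw [distinguishingAdvantage_raiseThen]
  have h := abs_distinguishingAdvantage_sub_le (ι := Fin n) (addConv (discretizedGaussian Q t) (discretizedGaussian Q u))
    (discretizedGaussian Q (Real.sqrt (t ^ 2 + u ^ 2))) m D
  have htv := tvDist_addConv_discretizedGaussian_le Q ht u
  rw [abs_le] at h
  nlinarith [h.1, mul_le_mul_of_nonneg_left htv (Nat.cast_nonneg m)]

end Raise

end LWE

end Literature.Computability.Cryptography

end
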